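import Summits.KontsevichZagierPeriods.KontsevichZagierPeriods.Theses.StandardParts

/-!
# Route StandardParts — `Assembly` (stmt-KontsevichZagierPeriods-3158)

The assembly of route StandardParts on the Kontsevich–Zagier period conjecture
(Kontsevich–Zagier 2001, §1.2, Conjecture 1): `SpArcClosure → SpArcLifting → KontsevichZagierPeriods`.

Pure logic. Given KZ-rational representations `r`, `r'` with equal values, `SpArcLifting` supplies two
one-parameter families `R`, `R'` of integral representations over `t ∈ (0,1)` with `ℚ`-semialgebraic
total domains and total integrands, fibrewise KZ-equivalent (`R t ~ R' t` for every `t ∈ (0,1)`), whose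
extended-by-zero integrands converge in `L¹` to those of `r`, `r'` as `t → 0⁺`; `SpArcClosure` applied
to exactly these data gives `KZ.Equivalent r r'`, which is the summit statement
`KontsevichZagierPeriods = Literature.Periods.KZPeriodConjecture` at `(r, r')`.

Nothing else is used (no semialgebraic geometry, no measure theory): the two hypotheses were cut so
that their conjunction is literally the summit split along "existence of an arc of identities" /
"closedness at the endpoint".
-/

namespace Summit.KontsevichZagierPeriods.StandardParts

/-- Settles stmt-KontsevichZagierPeriods-3158 (`Assembly` of route StandardParts):
`SpArcClosure → SpArcLifting → KontsevichZagierPeriods`. For equal-valued KZ-rational `r`, `r'`,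
`SpArcLifting` yields fibrewise-equivalent `ℚ`-semialgebraic arcs `R`, `R'` with `L¹`-endpoints
`r`, `r'`; `SpArcClosure` applied to them gives `KZ.Equivalent r r'`. [folklore] -/
theorem assembly_proof :
    Summit.KontsevichZagierPeriods.KontsevichZagierPeriods.Theses.StandardParts.Assembly := by
  unfold Summit.KontsevichZagierPeriods.KontsevichZagierPeriods.Theses.StandardParts.Assembly
  intro hClosure hLifting n m r r' hr hr' hv
  obtain ⟨R, R', hR, hRf, hR', hR'f, heq, hlim, hlim'⟩ := hLifting r r' hr hr' hv
  exact hClosure R R' r r' hR hRf hR' hR'f heq hlim hlim'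

end Summit.KontsevichZagierPeriods.StandardParts
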